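import Mathlib
import Literature.Analysis.FluidPDE.SelfSimilarEulerSwirlingFixedPoint
import Literature.Analysis.FluidPDE.AxisymPoloidalPart
import Literature.Analysis.FluidPDE.VortexFilament.CurlEnergy
import Summits.NavierStokesRegularity.NavierStokesRegularity.Theorems.EulerZoomLiouvillePowerGaugeEulerLiouvilleSelfSimilarSwirlRatchet
import Summits.NavierStokesRegularity.NavierStokesRegularity.Theorems.EulerZoomLiouvillePowerGaugeEulerLiouvilleSelfSimilarSwirlBudgetTools
import HarnessLib

/-!
# Crux E `PowerGaugeEulerLiouville` (stmt-NavierStokesRegularity-19832), THE ONE STATEMENT `stub_selfSimilarC2Needle`, target T1: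
# «THE AXISYMMETRIC NEEDLE HAS NO SWIRL» (2/4) — the swirl maximum over a solid cylinder sits at a strict-inflow boundary point
# (width seat ns-ezl-w3 g4; sequel of g3's `SwirlRatchet.swirlMax_boundary_inflow` / `swirl_piercing` for balls)

Route №10 `EulerZoomLiouville` (NavierStokesRegularity), crux E; LEAD ns-typeII-p2 g12.  For an axisymmetric self-similar Euler profile `(U, P)` (CIV (3.3),
`W = γy + U`, `γ < ½`) the swirl `Γ = swirl U = rU_θ` obeys `DΓ[W] = −(1−2γ)Γ` (`SwirlRatchet.fderiv_swirl_transport`).  Replace g3's balls by the SOLID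
CYLINDERS `K = {r ≤ R, H₁ ≤ z ≤ H₂}` (`H₁ ≤ 0 ≤ H₂`):

* `fderiv_apply_nonpos_of_isMaxOn` — Fermat along a direction `v` that enters `K` for small positive times (1-D reduction, no convexity needed);
* **`swirlMax_cylinder_trichotomy`** — if `a ∈ K` maximises `Γ²` over `K` and `Γ(a) ≠ 0`, then `a` is a STRICT-INFLOW boundary point of one of three kinds:
  LATERAL (`r(a) = R`, `a_h·W_h(a) < 0`), TOP (`a₂ = H₂`, `W₂(a) < 0`) or BOTTOM (`a₂ = H₁`, `W₂(a) > 0`) — otherwise `−W(a) − εa` enters `K` and Fermat gives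
  `2(1−2γ)Γ(a)² ≤ ε·D(Γ²)(a)[a]` for every `ε > 0`; in each case `‖U a‖ > γR`, `> γH₂`, `> γ|H₁|` respectively (`norm_gt_of_…`);
* `exists_rotZ_eq_normalForm` / `rotZ_normalForm` — rotate a point to `(r, 0, z)` and back to `(r cos θ, r sin θ, z)`; `norm_apply_rotZ`, `swirl_apply_rotZ`.

The two face estimates (x-lines from the circle in a quiet plane; vertical lines on a quiet cylinder) and the theorem follow in `…SwirlBudgetFaces` /
`…SwirlBudget`.

WHAT THIS IS NOT: not NS regularity, not the crux E — a portrait tool for THE ONE STATEMENT of the crux CLASS 19832 (MODEL lattice; E/NS strata),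
`--supports` stmt-19832; 19832 OPEN. [cite: Chae2007CMPEuler, Thm 2.2 + Note added p. 6; ConstantinIgnatovaVicol2026Putative, §4.4 proof of Thm 4.6]
-/

noncomputable section

-- flat `Theorems/<Route><Decl>…` files of one crux share the namespace of the crux (tree convention: `Summit.<S>.<S>.…`)
set_option linter.dupNamespace false

open MeasureTheory Set Filter Topology Metric Function InnerProductSpace
open scoped RealInnerProductSpace NNReal ENNReal

namespace Summit.NavierStokesRegularity.NavierStokesRegularity.Theorems.PowerGaugeEulerLiouville

namespace SwirlBudget

open Literature.Analysis Literature.Analysis.FluidPDE Literature.Analysis.FunctionSpaces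

variable {γ : ℝ} {U : EuclideanSpace ℝ (Fin 3) → EuclideanSpace ℝ (Fin 3)} {P : EuclideanSpace ℝ (Fin 3) → ℝ}

/-! ### Points in Cartesian and cylindrical form -/

/-- Coordinates of `(s, t, z)`. [folklore] -/
@[simp] theorem cart_apply_zero (s t z : ℝ) : (WithLp.toLp 2 ![s, t, z] : EuclideanSpace ℝ (Fin 3)) 0 = s := rfl
/-- Coordinates of `(s, t, z)`. [folklore] -/
@[simp] theorem cart_apply_one (s t z : ℝ) : (WithLp.toLp 2 ![s, t, z] : EuclideanSpace ℝ (Fin 3)) 1 = t := rfl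
/-- Coordinates of `(s, t, z)`. [folklore] -/
@[simp] theorem cart_apply_two (s t z : ℝ) : (WithLp.toLp 2 ![s, t, z] : EuclideanSpace ℝ (Fin 3)) 2 = z := rfl

/-- A point `(s, t, z)` with `s² + t² + z² < M²`, `0 < M`, lies in the ball `B(0, M)` (`‖(s,t,z)‖² = s²+t²+z²` is
`Literature…VortexFilament.norm_sq_toLp_three`). [folklore] -/
theorem cart_mem_ball {s t z M : ℝ} (hM : 0 < M) (h : s ^ 2 + t ^ 2 + z ^ 2 < M ^ 2) :
    (WithLp.toLp 2 ![s, t, z] : EuclideanSpace ℝ (Fin 3)) ∈ ball (0 : EuclideanSpace ℝ (Fin 3)) M := by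
  rw [mem_ball_zero_iff, ← abs_of_pos hM, ← abs_norm, ← sq_lt_sq, VortexFilament.norm_sq_toLp_three]
  exact h

/-- The cylinder radius of `(s, 0, z)` with `s ≥ 0` is `s`. [folklore] -/
theorem cylRadius_cart_zero {s : ℝ} (hs : 0 ≤ s) (z : ℝ) :
    cylRadius (WithLp.toLp 2 ![s, 0, z] : EuclideanSpace ℝ (Fin 3)) = s := by
  rw [cylRadius, cart_apply_zero, cart_apply_one]
  simp [Real.sqrt_sq hs]

/-- The affine `x₀`-line through `(0, t, z)`: `(0, t, z) + x • e₀ = (x, t, z)`. [folklore] -/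
theorem cart_eq_add_smul_single_zero (x t z : ℝ) :
    (WithLp.toLp 2 ![0, t, z] : EuclideanSpace ℝ (Fin 3)) + x • EuclideanSpace.single 0 1 = WithLp.toLp 2 ![x, t, z] := by
  ext i
  fin_cases i <;> simp

/-- The vertical line through `(s, t, 0)`: `(s, t, 0) + z • e₂ = (s, t, z)`. [folklore] -/
theorem cart_eq_add_smul_single_two (s t z : ℝ) :
    (WithLp.toLp 2 ![s, t, 0] : EuclideanSpace ℝ (Fin 3)) + z • EuclideanSpace.single 2 1 = WithLp.toLp 2 ![s, t, z] := by
  ext i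
  fin_cases i <;> simp

/-- Rotating the normal form: `R_θ (r, 0, z) = (r cos θ, r sin θ, z)`. [folklore] -/
theorem rotZ_normalForm (θ r z : ℝ) :
    rotZ θ (WithLp.toLp 2 ![r, 0, z]) = WithLp.toLp 2 ![r * Real.cos θ, r * Real.sin θ, z] := by
  ext i
  fin_cases i <;> simp [rotZ_apply_zero, rotZ_apply_one] <;> ring

/-- **Normal form under rotation about the axis**: every point can be rotated to `(r, 0, z)` with `r` its cylinder radius and `z` its height.
[folklore] -/
theorem exists_rotZ_eq_normalForm (a : EuclideanSpace ℝ (Fin 3)) :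
    ∃ θ : ℝ, rotZ θ a = WithLp.toLp 2 ![cylRadius a, 0, a 2] := by
  obtain ⟨α, h0, h1⟩ := Calculus.exists_apply_eq_norm_mul_cos_sin (WithLp.toLp 2 ![a 0, a 1])
  have hn : ‖(WithLp.toLp 2 ![a 0, a 1] : EuclideanSpace ℝ (Fin 2))‖ = cylRadius a := by
    rw [Calculus.norm_toLp_fin_two]; rfl
  rw [hn] at h0 h1
  simp only [Matrix.cons_val_zero, Matrix.cons_val_one] at h0 h1
  refine ⟨-α, ?_⟩
  ext i
  fin_cases i
  · show Real.cos (-α) * a 0 - Real.sin (-α) * a 1 = cylRadius a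
    rw [Real.cos_neg, Real.sin_neg, h0, h1]
    linear_combination cylRadius a * Real.cos_sq_add_sin_sq α
  · show Real.sin (-α) * a 0 + Real.cos (-α) * a 1 = 0
    rw [Real.cos_neg, Real.sin_neg, h0, h1]
    ring
  · rfl

/-! ### Consequences of axisymmetry -/

/-- Axisymmetry preserves the speed along circles about the axis: `‖U(R_θ x)‖ = ‖U x‖`. [folklore] -/
theorem norm_apply_rotZ (hU : IsAxisymmetric U) (θ : ℝ) (x : EuclideanSpace ℝ (Fin 3)) : ‖U (rotZ θ x)‖ = ‖U x‖ := by
  rw [hU θ x, norm_rotZ]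

/-- Axisymmetry preserves the swirl along circles about the axis: `Γ(R_θ x) = Γ(x)`. [folklore] -/
theorem swirl_apply_rotZ (hU : IsAxisymmetric U) (θ : ℝ) (x : EuclideanSpace ℝ (Fin 3)) : swirl U (rotZ θ x) = swirl U x :=
  swirl_rotZ_of_eq (hU θ x)

/-! ### Fermat along an entering direction -/

/-- **Fermat along an entering direction.**  If `f` is differentiable at `a` with derivative `f'`, `a` maximises `f` on `K`, and `a + s•v ∈ K` for all small
`s > 0`, then `f' v ≤ 0`.  (Restrict to the segment: `s ↦ f(a + s v)` has a maximum at `0` on `[0, δ]`.) [folklore] -/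
theorem fderiv_apply_nonpos_of_isMaxOn {f : EuclideanSpace ℝ (Fin 3) → ℝ} {f' : EuclideanSpace ℝ (Fin 3) →L[ℝ] ℝ}
    {K : Set (EuclideanSpace ℝ (Fin 3))} {a v : EuclideanSpace ℝ (Fin 3)}
    (hf : HasFDerivAt f f' a) (hmax : IsMaxOn f K a) (hK : ∀ᶠ s in 𝓝[>] (0 : ℝ), a + s • v ∈ K) : f' v ≤ 0 := by
  obtain ⟨δ, hδ, hsub⟩ := mem_nhdsGT_iff_exists_Ioo_subset.1 hK
  have hδ0 : 0 < δ := hδ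
  set φ : ℝ → ℝ := fun s => f (a + s • v) with hφ
  have hline : HasDerivAt (fun s : ℝ => a + s • v) v 0 := by
    have h := ((hasDerivAt_id (0 : ℝ)).smul_const v).const_add a
    simpa using h
  have hφd : HasDerivAt φ (f' v) 0 := by
    have h0 : a + (0 : ℝ) • v = a := by simp
    have hf0 : HasFDerivAt f f' (a + (0 : ℝ) • v) := by rw [h0]; exact hf
    exact hf0.comp_hasDerivAt (0 : ℝ) hline
  -- `φ ≤ φ 0` on `[0, δ/2]`
  have hmaxφ : IsMaxOn φ (Icc 0 (δ / 2)) 0 := by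
    intro s hs
    simp only [mem_setOf_eq, hφ, zero_smul, add_zero]
    rcases eq_or_lt_of_le hs.1 with h0 | h0
    · rw [← h0]; simp
    · exact hmax (hsub ⟨h0, by linarith [hs.2]⟩)
  have hcone : δ / 2 ∈ posTangentConeAt (Icc (0 : ℝ) (δ / 2)) 0 := by
    apply mem_posTangentConeAt_of_segment_subset
    rw [zero_add, segment_eq_Icc (by linarith : (0 : ℝ) ≤ δ / 2)]
  have h := hmaxφ.localize.hasFDerivWithinAt_nonpos hφd.hasFDerivAt.hasFDerivWithinAt hcone
  -- `h : (toSpanSingleton ℝ (f' v)) (δ/2) ≤ 0`, i.e. `(δ/2) • f' v ≤ 0`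
  rw [ContinuousLinearMap.toSpanSingleton_apply, smul_eq_mul] at h
  nlinarith

/-! ### The swirl maximum over a solid cylinder -/

/-- **THE SWIRL MAXIMUM OVER A SOLID CYLINDER SITS AT A STRICT-INFLOW BOUNDARY POINT (trichotomy).**  `(U, P)` a `C²` self-similar Euler profile (CIV (3.3)),
`U` axisymmetric, `γ < ½`; `K = {r ≤ R, H₁ ≤ z ≤ H₂}` with `0 < R`, `H₁ ≤ 0 ≤ H₂`.  If `a ∈ K` maximises `Γ²` over `K` and `Γ(a) ≠ 0`, then (with `W = γy + U`):
LATERAL `r(a) = R ∧ a₀W₀(a) + a₁W₁(a) < 0`, or TOP `a₂ = H₂ ∧ W₂(a) < 0`, or BOTTOM `a₂ = H₁ ∧ W₂(a) > 0`.  (Otherwise, for every `ε > 0`, the direction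
`−W(a) − εa` enters `K` for small times, and Fermat gives `2(1−2γ)Γ(a)² = −D(Γ²)(a)[W] ≤ ε·D(Γ²)(a)[a]` — absurd as `ε ↓ 0`.)
[cite: Chae2007CMPEuler, Thm 2.2 + Note added p. 6] -/
theorem swirlMax_cylinder_trichotomy (h : IsSelfSimilarEulerProfile γ 0 U P) (hU : IsAxisymmetric U) (hγ2 : γ < 1 / 2)
    {R H₁ H₂ : ℝ} (hR : 0 < R) (hH₁ : H₁ ≤ 0) (hH₂ : 0 ≤ H₂) {a : EuclideanSpace ℝ (Fin 3)}
    (ha : a ∈ {y : EuclideanSpace ℝ (Fin 3) | cylRadius y ≤ R ∧ y 2 ∈ Icc H₁ H₂})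
    (hmax : IsMaxOn (fun y => swirl U y ^ 2) {y : EuclideanSpace ℝ (Fin 3) | cylRadius y ≤ R ∧ y 2 ∈ Icc H₁ H₂} a)
    (hΓ : swirl U a ≠ 0) :
    (cylRadius a = R ∧ a 0 * (γ * a 0 + U a 0) + a 1 * (γ * a 1 + U a 1) < 0) ∨
      (a 2 = H₂ ∧ γ * H₂ + U a 2 < 0) ∨ (a 2 = H₁ ∧ 0 < γ * H₁ + U a 2) := by
  by_contra hnot
  simp only [not_or, not_and, not_lt] at hnot
  obtain ⟨hlat, htop, hbot⟩ := hnot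
  -- the derivative of `Γ²` and the ratchet at `a`
  have hΓd : Differentiable ℝ (swirl U) := (contDiff_swirl h.contDiff_velocity).differentiable (by norm_num)
  set Lf : EuclideanSpace ℝ (Fin 3) →L[ℝ] ℝ := fderiv ℝ (swirl U) a with hLf
  set f' : EuclideanSpace ℝ (Fin 3) →L[ℝ] ℝ := (2 * swirl U a) • Lf with hf'
  have hf : HasFDerivAt (fun y => swirl U y ^ 2) f' a := by
    have h1 := (hΓd a).hasFDerivAt.pow 2
    simpa [hf', hLf, pow_one] using h1
  set W : EuclideanSpace ℝ (Fin 3) := selfSimilarTransport γ 0 U a with hW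
  have hWa : W = γ • a + U a := by rw [hW, selfSimilarTransport_apply, sub_zero]
  have hWi : ∀ i, W i = γ * a i + U a i := fun i => by rw [hWa]; simp
  have hLW : Lf W = -((1 - 2 * γ) * swirl U a) := SwirlRatchet.fderiv_swirl_transport h hU a
  have hΓ2 : 0 < swirl U a ^ 2 := by positivity
  have h12 : 0 < 1 - 2 * γ := by linarith
  have hfW : f' W = -(2 * (1 - 2 * γ) * swirl U a ^ 2) := by
    have e1 : f' W = (2 * swirl U a) * Lf W := by rw [hf']; rfl
    rw [e1, hLW]; ring
  -- the key: for every `ε > 0`, `−W − ε a` enters `K`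
  have hK : ∀ ε : ℝ, 0 < ε → ∀ᶠ s in 𝓝[>] (0 : ℝ),
      a + s • (-W - ε • a) ∈ {y : EuclideanSpace ℝ (Fin 3) | cylRadius y ≤ R ∧ y 2 ∈ Icc H₁ H₂} := by
    intro ε hε
    set v : EuclideanSpace ℝ (Fin 3) := -W - ε • a with hv
    have hvi : ∀ i, v i = -(γ * a i + U a i) - ε * a i := fun i => by rw [hv]; simp [hWi]
    have hcomp : ∀ (s : ℝ) (i : Fin 3), (a + s • v) i = a i + s * v i := fun s i => by simp
    obtain ⟨har, ha2⟩ := ha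
    -- (z, upper)
    have hup : ∀ᶠ s in 𝓝[>] (0 : ℝ), (a + s • v) 2 ≤ H₂ := by
      rcases eq_or_lt_of_le ha2.2 with he | hlt
      · -- `a₂ = H₂`: then `W₂ ≥ 0`, and the height does not increase
        have hW2 : 0 ≤ γ * a 2 + U a 2 := by have := htop he; rwa [he]
        refine eventually_nhdsWithin_of_forall fun s (hs : 0 < s) => ?_
        rw [hcomp, hvi, he]
        rw [he] at hW2
        nlinarith [mul_nonneg hs.le hW2, mul_nonneg hs.le (mul_nonneg hε.le hH₂)]
      · have hc : Continuous fun s : ℝ => (a + s • v) 2 := by simp only [hcomp]; fun_prop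
        have ht : Tendsto (fun s : ℝ => (a + s • v) 2) (𝓝[>] 0) (𝓝 (a 2)) := by
          have := hc.tendsto 0
          simp only [zero_smul, add_zero] at this
          exact tendsto_nhdsWithin_of_tendsto_nhds this
        exact (ht.eventually_lt_const hlt).mono fun s hs => hs.le
    -- (z, lower)
    have hlo : ∀ᶠ s in 𝓝[>] (0 : ℝ), H₁ ≤ (a + s • v) 2 := by
      rcases eq_or_lt_of_le ha2.1 with he | hlt
      · have hW2 : γ * a 2 + U a 2 ≤ 0 := by have := hbot he.symm; rwa [← he]
        refine eventually_nhdsWithin_of_forall fun s (hs : 0 < s) => ?_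
        rw [hcomp, hvi, ← he]
        rw [← he] at hW2
        have h1 : 0 ≤ -(γ * H₁ + U a 2) := by linarith
        have h2 : 0 ≤ -H₁ := by linarith
        nlinarith [mul_nonneg hs.le h1, mul_nonneg hs.le (mul_nonneg hε.le h2)]
      · have hc : Continuous fun s : ℝ => (a + s • v) 2 := by simp only [hcomp]; fun_prop
        have ht : Tendsto (fun s : ℝ => (a + s • v) 2) (𝓝[>] 0) (𝓝 (a 2)) := by
          have := hc.tendsto 0
          simp only [zero_smul, add_zero] at this
          exact tendsto_nhdsWithin_of_tendsto_nhds this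
        exact (ht.eventually_const_lt hlt).mono fun s hs => hs.le
    -- (radial)
    have hrad : ∀ᶠ s in 𝓝[>] (0 : ℝ), cylRadius (a + s • v) ≤ R := by
      -- work with `q(s) = (a₀ + s v₀)² + (a₁ + s v₁)² = r² + s (2⟨a_h, v_h⟩ + s |v_h|²)`
      have hr2 : a 0 ^ 2 + a 1 ^ 2 ≤ R ^ 2 := by
        rw [← cylRadius_sq]; exact pow_le_pow_left₀ (cylRadius_nonneg a) har 2
      have key : ∀ s : ℝ, 0 < s → 2 * (a 0 * v 0 + a 1 * v 1) + s * (v 0 ^ 2 + v 1 ^ 2) ≤ 0 →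
          cylRadius (a + s • v) ≤ R := by
        intro s hs hq
        rw [cylRadius]
        calc Real.sqrt ((a + s • v) 0 ^ 2 + (a + s • v) 1 ^ 2) ≤ Real.sqrt (R ^ 2) := by
              apply Real.sqrt_le_sqrt
              rw [hcomp, hcomp]
              nlinarith
          _ = R := Real.sqrt_sq hR.le
      rcases eq_or_lt_of_le har with he | hlt
      · -- `r(a) = R`: then `a_h · W_h ≥ 0`, so `a_h · v_h ≤ −εR² < 0`
        have hin : 0 ≤ a 0 * (γ * a 0 + U a 0) + a 1 * (γ * a 1 + U a 1) := hlat he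
        have hR2 : a 0 ^ 2 + a 1 ^ 2 = R ^ 2 := by rw [← cylRadius_sq, he]
        have hneg : 2 * (a 0 * v 0 + a 1 * v 1) < 0 := by
          rw [hvi, hvi]
          nlinarith [pow_pos hR 2]
        have hc : Continuous fun s : ℝ => 2 * (a 0 * v 0 + a 1 * v 1) + s * (v 0 ^ 2 + v 1 ^ 2) := by fun_prop
        have ht : Tendsto (fun s : ℝ => 2 * (a 0 * v 0 + a 1 * v 1) + s * (v 0 ^ 2 + v 1 ^ 2)) (𝓝[>] 0)
            (𝓝 (2 * (a 0 * v 0 + a 1 * v 1))) := by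
          have := hc.tendsto 0
          simp only [zero_mul, add_zero] at this
          exact tendsto_nhdsWithin_of_tendsto_nhds this
        filter_upwards [ht.eventually_lt_const hneg, self_mem_nhdsWithin] with s hs hs0
        exact key s hs0 hs.le
      · -- `r(a) < R`: continuity
        have hlt2 : a 0 ^ 2 + a 1 ^ 2 < R ^ 2 := by
          rw [← cylRadius_sq]; exact pow_lt_pow_left₀ hlt (cylRadius_nonneg a) two_ne_zero
        have hc : Continuous fun s : ℝ => (a + s • v) 0 ^ 2 + (a + s • v) 1 ^ 2 := by simp only [hcomp]; fun_prop
        have ht : Tendsto (fun s : ℝ => (a + s • v) 0 ^ 2 + (a + s • v) 1 ^ 2) (𝓝[>] 0) (𝓝 (a 0 ^ 2 + a 1 ^ 2)) := by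
          have := hc.tendsto 0
          simp only [zero_smul, add_zero] at this
          exact tendsto_nhdsWithin_of_tendsto_nhds this
        filter_upwards [ht.eventually_lt_const hlt2] with s hs
        rw [cylRadius]
        calc Real.sqrt ((a + s • v) 0 ^ 2 + (a + s • v) 1 ^ 2) ≤ Real.sqrt (R ^ 2) := Real.sqrt_le_sqrt hs.le
          _ = R := Real.sqrt_sq hR.le
    filter_upwards [hup, hlo, hrad] with s h1 h2 h3
    exact ⟨h3, h2, h1⟩
  -- Fermat: `f' (−W − ε a) ≤ 0`, i.e. `2(1−2γ)Γ² ≤ ε f' a`, for every `ε > 0`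
  have hF : ∀ ε : ℝ, 0 < ε → 2 * (1 - 2 * γ) * swirl U a ^ 2 ≤ ε * f' a := by
    intro ε hε
    have h1 := fderiv_apply_nonpos_of_isMaxOn hf hmax (hK ε hε)
    rw [map_sub, map_neg, map_smul, smul_eq_mul, hfW] at h1
    linarith
  have hpos : 0 < 2 * (1 - 2 * γ) * swirl U a ^ 2 := by positivity
  rcases le_or_gt (f' a) 0 with hfa | hfa
  · have := hF 1 one_pos
    nlinarith
  · -- `ε = (1−2γ)Γ²/f'(a)` gives `2x ≤ x` with `x > 0`
    have := hF ((1 - 2 * γ) * swirl U a ^ 2 / f' a) (by positivity)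
    rw [div_mul_cancel₀ _ hfa.ne'] at this
    nlinarith

/-- From the trichotomy to a SPEED LOWER BOUND at the maximum: lateral ⇒ `‖U a‖ > γR`. [folklore (Cauchy–Schwarz in the horizontal plane)] -/
theorem norm_gt_of_lateral (hγ : 0 ≤ γ) {R : ℝ} (hR : 0 < R) {a : EuclideanSpace ℝ (Fin 3)} (har : cylRadius a = R)
    (hin : a 0 * (γ * a 0 + U a 0) + a 1 * (γ * a 1 + U a 1) < 0) : γ * R < ‖U a‖ := by
  have hR2 : a 0 ^ 2 + a 1 ^ 2 = R ^ 2 := by rw [← cylRadius_sq, har]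
  -- `a₀U₀ + a₁U₁ < −γR²` and `|a₀U₀ + a₁U₁| ≤ R √(U₀² + U₁²) ≤ R ‖U a‖`
  have h1 : a 0 * U a 0 + a 1 * U a 1 < -(γ * R ^ 2) := by nlinarith
  have hU0 : |U a 0| ≤ ‖U a‖ := by have := PiLp.norm_apply_le (U a) 0; rwa [Real.norm_eq_abs] at this
  have hU1 : |U a 1| ≤ ‖U a‖ := by have := PiLp.norm_apply_le (U a) 1; rwa [Real.norm_eq_abs] at this
  have hn : 0 ≤ ‖U a‖ := norm_nonneg _
  -- Cauchy–Schwarz: `(a₀U₀ + a₁U₁)² ≤ (a₀² + a₁²)(U₀² + U₁²) ≤ R² · 2‖U a‖²` is too weak; use the exact planar form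
  have hcs : (a 0 * U a 0 + a 1 * U a 1) ^ 2 ≤ (a 0 ^ 2 + a 1 ^ 2) * (U a 0 ^ 2 + U a 1 ^ 2) := by
    nlinarith [sq_nonneg (a 0 * U a 1 - a 1 * U a 0)]
  have hUU : U a 0 ^ 2 + U a 1 ^ 2 ≤ ‖U a‖ ^ 2 := by
    have e : ‖U a‖ ^ 2 = ∑ i, ‖U a i‖ ^ 2 := by
      rw [EuclideanSpace.norm_eq, Real.sq_sqrt (Finset.sum_nonneg fun i _ => sq_nonneg _)]
    rw [e, Fin.sum_univ_three]
    simp only [Real.norm_eq_abs, sq_abs]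
    nlinarith [sq_nonneg (U a 2)]
  have h2 : (γ * R ^ 2) ^ 2 < (a 0 * U a 0 + a 1 * U a 1) ^ 2 := by
    have hγR : 0 ≤ γ * R ^ 2 := by positivity
    have hA : a 0 * U a 0 + a 1 * U a 1 + γ * R ^ 2 < 0 := by linarith
    have hB : a 0 * U a 0 + a 1 * U a 1 - γ * R ^ 2 < 0 := by linarith
    have hAB := mul_pos_of_neg_of_neg hA hB
    nlinarith [hAB]
  have h3 : (γ * R ^ 2) ^ 2 < R ^ 2 * ‖U a‖ ^ 2 := by
    calc (γ * R ^ 2) ^ 2 < (a 0 * U a 0 + a 1 * U a 1) ^ 2 := h2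
      _ ≤ (a 0 ^ 2 + a 1 ^ 2) * (U a 0 ^ 2 + U a 1 ^ 2) := hcs
      _ ≤ R ^ 2 * ‖U a‖ ^ 2 := by rw [hR2]; exact mul_le_mul_of_nonneg_left hUU (sq_nonneg _)
  have h4 : (γ * R) ^ 2 < ‖U a‖ ^ 2 := by
    have e : (γ * R ^ 2) ^ 2 = R ^ 2 * (γ * R) ^ 2 := by ring
    rw [e] at h3
    exact lt_of_mul_lt_mul_left h3 (sq_nonneg _)
  exact (pow_lt_pow_iff_left₀ (by positivity) hn two_ne_zero).1 h4

/-- Top ⇒ `‖U a‖ > γH₂`. [folklore] -/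
theorem norm_gt_of_top {H₂ : ℝ} {a : EuclideanSpace ℝ (Fin 3)} (hin : γ * H₂ + U a 2 < 0) (hγH : 0 ≤ γ * H₂) : γ * H₂ < ‖U a‖ := by
  have hU2 : |U a 2| ≤ ‖U a‖ := by have := PiLp.norm_apply_le (U a) 2; rwa [Real.norm_eq_abs] at this
  have : γ * H₂ < |U a 2| := by rw [abs_of_neg (by linarith)]; linarith
  exact this.trans_le hU2

/-- Bottom ⇒ `‖U a‖ > γ|H₁| = −γH₁`. [folklore] -/
theorem norm_gt_of_bottom {H₁ : ℝ} {a : EuclideanSpace ℝ (Fin 3)} (hin : 0 < γ * H₁ + U a 2) (hγH : γ * H₁ ≤ 0) : -(γ * H₁) < ‖U a‖ := by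
  have hU2 : |U a 2| ≤ ‖U a‖ := by have := PiLp.norm_apply_le (U a) 2; rwa [Real.norm_eq_abs] at this
  have : -(γ * H₁) < |U a 2| := by rw [abs_of_pos (by linarith)]; linarith
  exact this.trans_le hU2

end SwirlBudget

end Summit.NavierStokesRegularity.NavierStokesRegularity.Theorems.PowerGaugeEulerLiouville

end
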